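import Summits.CriticalPhenomena.SAWScalingLimit.Theorems.SAWLoopFugacityFlowAvoidanceLimitWallsSeparate
import Summits.CriticalPhenomena.SAWScalingLimit.Theorems.SAWLoopFugacityFlowAvoidanceLimitGoodSeparator
import Summits.CriticalPhenomena.SAWScalingLimit.Theorems.SAWLoopFugacityFlowAvoidanceLimitHubTwoSided
import Literature.Probability.LatticeModels.EdgeKilledAnnulusManeuver
import Literature.Probability.LatticeModels.GermRegionLattice
import Literature.Probability.LatticeModels.KilledWalkPotential
import Literature.Probability.LatticeModels.EdgeFirstExit
import HarnessLib

/-!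
# The factorisation upper bound at the hub from the existence of good walls

Sub-problem `CriticalPhenomena/SAWScalingLimit`, crux `AvoidanceLimit`, line `symplectic-fermion-anchor` (lead c7), stub
`stub_germUpper` (skeleton v14: `GermUpper`, the factorisation upper bound `P(u,x) ≤ C₀·hitProb_{hub}(u)·P(z,x)` at an admissible
hub — Chelkak 2016 Prop. 3.3 for the edge-killed walk in the lattice germ regions). This file isolates the analytic kernel: IF for
every admissible hub datum and every outer exit `x` there are two lattice walls from the hub centre `z` to a T-death and a B-death
(the data of `walls_separate`, p170378) all of whose sites off the hub box are GOOD — `P(v,x) ≤ C₁·P(z,x)·hitProb_{hub}(v)` —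
(the hypothesis, "GoodWalls"), THEN `GermUpper` holds with `C₀ = (2/maneuverConst)·(1 + C₁)`: the hub box `mB z k` carries
`P(·,x) ≤ (2/c_*) P(z,x)` (`hub_twoSided`), every walk from an inner exit `u` to `x` inside `Θ'` meets a wall (`walls_separate`), so
`P_{Θ'∖(B∪W)}(u,x) = 0` (`exists_walk_of_killedHarmExt_pos`), and `killedPoisson_le_of_goodSeparator` (p164062) concludes. What is
left of the stub is exactly the hypothesis GoodWalls (fat wall sites are good by `fatSite_good`; the wall TAILS in the protected one-arc zone
are the open kernel — crux NOTES.md §"hcore after lead c7"). [cite: Chelkak2016, Proposition 3.3]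
-/

noncomputable section

open scoped BigOperators Classical Topology
open Set Metric Filter
open Literature.Topology.PlaneTopology
open Literature.Probability.LatticeModels
open Literature.Probability.RandomPlanarGeometry (JordanDomain)
open Summit.CriticalPhenomena.CardyFormulaZ2.Cruxes.ParafermionPrecompact.KenyonStreamSecondRelation
  (mB_subset_mW')

namespace Summit.CriticalPhenomena.SAWScalingLimit.Theorems.AvoidanceLimit.Anchor

/-- **Abstract kernel: a good wall through a clean hub gives the factorisation upper bound.** For the
edge-killed walk `Gr` in a finite region `Λ`, a clean hub frame `mW z (2k) ⊆ Λ` (`k ≥ 1`), an exit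
`x ∉ Λ`, and a set `Wall ⊆ Λ` met by every walk from `u ∈ Λ` to `x` whose sites before `x` stay in
`Λ`: if every wall site off the hub box `mB z k` is good with constant `C₁`, then
`P_Λ(u,x) ≤ (2/c_*)(1 + C₁) · hitProb_{mB z k}(u) · P_Λ(z,x)`. Proof: on the hub
`P_Λ(·,x) ≤ (2/c_*) P_Λ(z,x)` (`hub_twoSided`); the kernel of `Λ ∖ (B ∪ W)` at `u` vanishes since a
walk realising a positive value (`exists_walk_of_killedHarmExt_pos`) would miss the wall; conclude by
`killedPoisson_le_of_goodSeparator` and `c_* ≤ 1`. [cite: Chelkak2016, Proposition 3.3] -/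
theorem killedPoisson_le_of_goodWall {Gr : SimpleGraph (Site 2)} {Λ : Set (Site 2)} (hΛ : Λ.Finite)
    {z : Site 2} {k : ℕ} (hk : 0 < k) (hWΛ : mW z (2 * k) ⊆ Λ)
    (hclean : ∀ w ∈ mW z (2 * k), ∀ e : SRW.Dir 2, Gr.Adj w (w + SRW.stepVec e))
    {x : Site 2} (hx : x ∉ Λ) {C₁ : ℝ} (hC₁ : 0 ≤ C₁) {Wall : Set (Site 2)} (hWallΛ : Wall ⊆ Λ)
    (hgood : ∀ v ∈ Wall, v ∉ mB z k →
      killedPoisson Gr Λ v x ≤ C₁ * killedPoisson Gr Λ z x * hitProb Gr Λ (mB z k) v)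
    {u : Site 2} (huΛ : u ∈ Λ)
    (hsep : ∀ p : Gr.Walk u x, (∀ v ∈ p.support, v ≠ x → v ∈ Λ) → ∃ v ∈ p.support, v ∈ Wall) :
    killedPoisson Gr Λ u x ≤
      2 / maneuverConst * (1 + C₁) * hitProb Gr Λ (mB z k) u * killedPoisson Gr Λ z x := by
  have hc := maneuverConst_pos
  have hc1 := maneuverConst_le_one
  have hBΛ : mB z k ⊆ Λ := (mB_subset_mW' z k).trans hWΛ
  obtain ⟨-, hii⟩ := hub_twoSided Gr Λ hΛ z k hk hWΛ hclean x
  have hPz0 : 0 ≤ killedPoisson Gr Λ z x := killedPoisson_nonneg hΛ z x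
  have hh0 : 0 ≤ hitProb Gr Λ (mB z k) u := hitProb_nonneg hΛ u
  -- the hub bound `M = (2/c_*) P_Λ(z,x)`
  have hM0 : 0 ≤ 2 / maneuverConst * killedPoisson Gr Λ z x := by positivity
  have hMB : ∀ w ∈ mB z k, killedPoisson Gr Λ w x ≤ 2 / maneuverConst * killedPoisson Gr Λ z x := by
    intro w hw
    have h := (hii w hw).1
    rw [div_mul_eq_mul_div, le_div_iff₀ hc]
    linarith
  -- the wall off the hub, its finset, and goodness with `C = C₁ c_* / 2`
  have hWfin : (Wall \ mB z k).Finite := hΛ.subset fun _ hv => hWallΛ hv.1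
  have hWf : ∀ w, w ∈ hWfin.toFinset ↔ w ∈ Wall \ mB z k := fun w => hWfin.mem_toFinset
  have hC0 : 0 ≤ C₁ * maneuverConst / 2 := by positivity
  have hgoodW : ∀ w ∈ Wall \ mB z k, killedPoisson Gr Λ w x ≤
      C₁ * maneuverConst / 2 * (2 / maneuverConst * killedPoisson Gr Λ z x) * hitProb Gr Λ (mB z k) w := by
    intro w hw
    have e : C₁ * maneuverConst / 2 * (2 / maneuverConst * killedPoisson Gr Λ z x) =
        C₁ * killedPoisson Gr Λ z x := by
      field_simp
    rw [e]
    exact hgood w hw.1 hw.2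
  -- separation: the exit kernel of `Λ ∖ (B ∪ W)` at `u` vanishes
  have hux : u ≠ x := fun h => hx (h ▸ huΛ)
  have hsep0 : killedPoisson Gr (Λ \ (mB z k ∪ Wall \ mB z k)) u x = 0 := by
    by_cases huS : u ∈ Λ \ (mB z k ∪ Wall \ mB z k)
    swap
    · rw [killedPoisson_of_not_mem huS, if_neg hux]
    have hSfin : (Λ \ (mB z k ∪ Wall \ mB z k)).Finite := hΛ.subset fun _ hv => hv.1
    by_contra hne
    have hpos : 0 < killedPoisson Gr (Λ \ (mB z k ∪ Wall \ mB z k)) u x :=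
      lt_of_le_of_ne (killedPoisson_nonneg hSfin u x) (Ne.symm hne)
    obtain ⟨w, hwS, hgw, p, hp⟩ := exists_walk_of_killedHarmExt_pos hSfin huS hpos
    have hwx : w = x := by
      by_contra h
      have : ¬ (0 : ℝ) < (fun w => if w = x then (1 : ℝ) else 0) w := by simp [h]
      exact this hgw
    have hp' : ∀ v ∈ (p.copy rfl hwx).support, v ≠ x → v ∈ Λ := by
      intro v hv hvx
      rw [SimpleGraph.Walk.support_copy] at hv
      rcases hp v hv with h | h
      · exact h.1
      · exact absurd (h.trans hwx) hvx
    obtain ⟨v, hvp, hvW⟩ := hsep (p.copy rfl hwx) hp'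
    rw [SimpleGraph.Walk.support_copy] at hvp
    rcases hp v hvp with hvS | hvw
    · refine hvS.2 ?_
      by_cases hvB : v ∈ mB z k
      · exact Or.inl hvB
      · exact Or.inr ⟨hvW, hvB⟩
    · refine hx ?_
      rw [← hvw.trans hwx]
      exact hWallΛ hvW
  have key := killedPoisson_le_of_goodSeparator Gr Λ (mB z k) (Wall \ mB z k) hΛ hBΛ hWfin.toFinset hWf
    x hx _ _ hM0 hC0 hMB hgoodW u huΛ hsep0
  have h1 : 1 + C₁ * maneuverConst / 2 ≤ 1 + C₁ := by nlinarith
  have h2 : 0 ≤ 2 / maneuverConst * killedPoisson Gr Λ z x * hitProb Gr Λ (mB z k) u := by positivity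
  calc killedPoisson Gr Λ u x
      ≤ (1 + C₁ * maneuverConst / 2) * (2 / maneuverConst * killedPoisson Gr Λ z x) *
          hitProb Gr Λ (mB z k) u := key
    _ = (1 + C₁ * maneuverConst / 2) *
          (2 / maneuverConst * killedPoisson Gr Λ z x * hitProb Gr Λ (mB z k) u) := by ring
    _ ≤ (1 + C₁) * (2 / maneuverConst * killedPoisson Gr Λ z x * hitProb Gr Λ (mB z k) u) :=
        mul_le_mul_of_nonneg_right h1 h2
    _ = 2 / maneuverConst * (1 + C₁) * hitProb Gr Λ (mB z k) u * killedPoisson Gr Λ z x := by ring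

/-- **The upper bound at the hub from good walls** (per configuration; the `∃`-packaging into the skeleton's `GermUpper` is
done in the line skeleton). Given the nested germ arcs, a clean hub frame `mW z (2k) ⊆ Θ'`, an outer exit `x`, and two walls from
`z` to a T-death and a B-death (data of `walls_separate`) whose sites off the hub box `mB z k` are good with constant `C₁`, every
inner exit `u ∈ Θ'` satisfies `P(u,x) ≤ (2/c_*)(1 + C₁) · hitProb_{Θ'}(mB z k)(u) · P(z,x)`. [cite: Chelkak2016, Proposition 3.3] -/
theorem goodWalls_upper :
    ∀ (D : JordanDomain) (b : ℂ) (s s' : ℝ) (hs : 0 < s) (hs' : 0 < s'), s < s' → ∀ (g o : ℂ),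
      TwoOff D (boxJD b hs) → TwoOff D (boxJD b hs') →
      g ∈ D.carrier ∩ Literature.Topology.PlaneTopology.box b s → o ∈ D.carrier → o ∉ closedBox b s' →
    ∀ (σ' θ₁ θ₂ τ' : ℝ), σ' < θ₁ → θ₁ < θ₂ → θ₂ < τ' → τ' < σ' + 1 →
      frontier (germRegion D b hs' g o) =
        gateArc D (boxJD b hs') (germGateParam D b hs' g o) ∪ D.boundary '' Set.Icc σ' τ' →
      frontier (germRegion D b hs g o) =
        gateArc D (boxJD b hs) (germGateParam D b hs g o) ∪ D.boundary '' Set.Icc θ₁ θ₂ →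
      ({D.boundary θ₁, D.boundary θ₂} : Set ℂ) =
        {(boxJD b hs).boundary (gateLo D (boxJD b hs) (germGateParam D b hs g o)),
         (boxJD b hs).boundary (gateHi D (boxJD b hs) (germGateParam D b hs g o))} →
      ({D.boundary σ', D.boundary τ'} : Set ℂ) =
        {(boxJD b hs').boundary (gateLo D (boxJD b hs') (germGateParam D b hs' g o)),
         (boxJD b hs').boundary (gateHi D (boxJD b hs') (germGateParam D b hs' g o))} →
    ∀ (δ : ℝ), 0 < δ → ∀ (z : Site 2) (k : ℕ), 0 < k →
      (∀ w ∈ mW z (2 * k), w ∈ germSites D b hs' g o δ ∧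
        ∀ e : SRW.Dir 2, (discreteDomainGraph D.carrier δ).Adj w (w + SRW.stepVec e)) →
    ∀ (C₁ : ℝ), 0 ≤ C₁ → ∀ x ∈ germExits D b hs' g o δ,
      (∃ (xT xB : Site 2) (pT : (discreteDomainGraph D.carrier δ).Walk z xT)
          (pB : (discreteDomainGraph D.carrier δ).Walk z xB) (eT eB : SRW.Dir 2),
          ¬ (discreteDomainGraph D.carrier δ).Adj xT (xT + SRW.stepVec eT) ∧
          edgeLanding D.carrier δ xT eT ∈ D.boundary '' Set.Ioo σ' θ₁ ∧
          ¬ (discreteDomainGraph D.carrier δ).Adj xB (xB + SRW.stepVec eB) ∧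
          edgeLanding D.carrier δ xB eB ∈ D.boundary '' Set.Ioo θ₂ τ' ∧
          (∀ v, v ∈ pT.support ∨ v ∈ pB.support → v ∈ germSites D b hs' g o δ ∧
            2 * δ < Metric.infDist (meshPoint δ v) (closure (germRegion D b hs g o)) ∧
            (∀ p ∈ gateArc D (boxJD b hs') (germGateParam D b hs' g o), 2 * δ < dist (meshPoint δ v) p) ∧
            (v ≠ xT → v ≠ xB → δ < Metric.infDist (meshPoint δ v) (frontier D.carrier))) ∧
          (∀ v, v ∈ pT.support ∨ v ∈ pB.support → v ∉ mB z k →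
            killedPoisson (discreteDomainGraph D.carrier δ) (germSites D b hs' g o δ) v x ≤
              C₁ * killedPoisson (discreteDomainGraph D.carrier δ) (germSites D b hs' g o δ) z x *
                hitProb (discreteDomainGraph D.carrier δ) (germSites D b hs' g o δ) (mB z k) v)) →
    ∀ u ∈ germExits D b hs g o δ, u ∈ germSites D b hs' g o δ →
      killedPoisson (discreteDomainGraph D.carrier δ) (germSites D b hs' g o δ) u x ≤
        2 / maneuverConst * (1 + C₁) *
          hitProb (discreteDomainGraph D.carrier δ) (germSites D b hs' g o δ) (mB z k) u *
            killedPoisson (discreteDomainGraph D.carrier δ) (germSites D b hs' g o δ) z x := by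
  intro D b s s' hs hs' hss' g o h2 h2' hg ho hoc σ' θ₁ θ₂ τ' hσθ hθθ hθτ hτσ hfU' hfU hendsU hends δ hδ
    z k hk hframe C₁ hC₁ x hx hwalls u hu huΘ
  obtain ⟨xT, xB, pT, pB, eT, eB, hT, hqT, hB, hqB, hwall, hgood⟩ := hwalls
  have hxΘ : x ∉ germSites D b hs' g o δ := (mem_germExits_iff.1 hx).1
  exact killedPoisson_le_of_goodWall (germSites_finite hδ) hk (fun w hw => (hframe w hw).1)
    (fun w hw => (hframe w hw).2) hxΘ hC₁ (Wall := {v | v ∈ pT.support ∨ v ∈ pB.support})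
    (fun v hv => (hwall v hv).1) (fun v hv hvB => hgood v hv hvB) huΘ
    (fun p hp => walls_separate D b s s' hs hs' hss' g o h2 h2' hg ho hoc σ' θ₁ θ₂ τ' hσθ hθθ hθτ hτσ
      hfU' hfU hendsU hends δ hδ z xT xB pT pB eT eB hT hqT hB hqB hwall u hu huΘ x hx p hp)

end Summit.CriticalPhenomena.SAWScalingLimit.Theorems.AvoidanceLimit.Anchor

end
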